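import Mathlib
import HarnessLib
import HarnessLib.Audit
import Summits.NavierStokesRegularity.NavierStokesRegularity.Theorems.L3TimeExponentPincerLocalMorreyRegularity
import Summits.NavierStokesRegularity.NavierStokesRegularity.Theorems.L3TimeExponentPincerSobolevMajorant

/-!
# Dissipation bursts of Morrey-Type-I blow-ups modulo (L)
# (crux `EffSatBlowup`, item `stmt-NavierStokesRegularity-19139`, route `L3TimeExponentPincer`, line `pace`, stub 2)

Support file (theorems only, no definition, no `sorry`; `--supports stmt-NavierStokesRegularity-19139`,
seat ns-pincer-19139-p1, gen 2; sequel to `…FullMorreyHardCoreMeet` (p475272), `…LocalMorreyZoom` (p477919),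
`…LocalMorreyRegularity` (p479457)).  Those files showed: if no local Type I singular point exists
(`¬ LocalTypeISingularityExists`, in particular under hard core 10661 (L)), a frame blow-up in stub 2's class
`MorreyTypeINear` (Barker–Prange 2020 (1.7), constant `M₀` below radius `r₁`) carries, near a singular point and in
every final window, sub-parabolic `L²` concentration `∫_{B(x₁,r)}|u(t)|² > M r` with `M r ≤ M₀ √(T-t)`, for EVERY
level `M`.  The Sobolev end of the scaled energy (nsreg-p4's `lintegral_ball_sq_le_sobolev`:
`∫_{B(x₁,r)}|w|² ≤ A δ(w) r²`, `A = sobolevMorreyConst`, `δ = dissipRate` the Frobenius dissipation rate) turns each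
such ball into a DISSIPATION FLOOR `A δ(t) > M / r ≥ M² / (M₀ √(T-t))`:

* `ofReal_div_lt_dissipRate_of_concentration` — a ball with `∫_{B(x₁,r)}|u(t)|² > M r` forces `A δ(t) > M/r`;
* `exists_dissipation_burst_near_of_not_isBackwardBoundedAt`, `exists_dissipation_burst_of_morreyTypeI_blowup` —
  **at a singular point of a Morrey-Type-I frame blow-up the dissipation exceeds every multiple of the
  self-similar (Leray) rate along a sequence of times: `∀ Λ, ∀ T₁ < T, ∃ t ∈ (T₁,T), A δ(t) > Λ/√(T-t)`**;
* `not_dissipLerayRate_of_morreyTypeI_blowup` — hence **no frame blow-up is simultaneously Morrey-Type-I on the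
  top windows (BP (1.7)) and of Leray rate in `Ḣ¹` (`‖∇u(t)‖₂² ≤ C (T-t)^{-1/2}` on a final window)**, modulo
  `¬ LocalTypeISingularityExists`; `…_of_typeIliouvilleL` — the same under hard core 10661 BY NAME.

Calibration (docstring only): Leray's lower bound gives `δ(t) ≥ c ν^{3/2} (T-t)^{-1/2}` for every blow-up, a
self-similar profile has exactly `δ ∼ (T-t)^{-1/2}`, and g0's sufficient node for stub 2 is the Type-I DISSIPATION
CEILING `δ ≤ D₀/(T-t)` (`…MorreyTypeIDissipationPace.stub2_of_dissipationTypeI`, p460580); the bursts proved here sit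
strictly between the two rates and are compatible with both.  CONDITIONAL results; nothing here closes item 19139.
References: J. Leray, Acta Math. 63 (1934), (3.8); D. Albritton, T. Barker, arXiv:1811.00502, Thm. 1.1;
T. Barker, C. Prange, arXiv:1812.09115, (1.7); J. C. Robinson, J. L. Rodrigo, W. Sadowski (2016), Thm. 1.8 / Lemma 3.5.
WHAT THIS IS NOT: not a proof of anything about Navier–Stokes regularity or blow-up; conditional reductions only.
-/

noncomputable section

namespace Summit.NavierStokesRegularity.NavierStokesRegularity.Theorems.L3TimeExponentPincerMorreyTypeIDissipationBursts

open Set Filter Topology MeasureTheory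
open Function TopologicalSpace Metric
open Literature.Analysis.FluidPDE
open scoped ENNReal NNReal
open Summit.NavierStokesRegularity.NavierStokesRegularity.Theorems.L3TimeExponentPincerPaceDichotomy
  (MorreyTypeINear)
open Summit.NavierStokesRegularity.NavierStokesRegularity.Theorems.L3TimeExponentPincerJawFullMorrey (dissipRate)
open Summit.NavierStokesRegularity.NavierStokesRegularity.Theorems.L3TimeExponentPincerSobolevMajorant
  (sobolevMorreyConst sobolevMorreyConst_lt_top lintegral_ball_sq_le_sobolev)
open Summit.NavierStokesRegularity.NavierStokesRegularity.Theorems.L3TimeExponentPincerLocalMorreyRegularity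
  (exists_deep_concentration_near_of_not_isBackwardBoundedAt exists_not_isBackwardBoundedAt_of_blowup)
open Summit.NavierStokesRegularity.NavierStokesRegularity.Theorems.L3TimeExponentPincerFullMorreyHardCoreMeet
  (not_localTypeISingularityExists_of_typeIliouvilleL)

variable {ν T : ℝ} {u : ℝ → EuclideanSpace ℝ (Fin 3) → EuclideanSpace ℝ (Fin 3)}
  {p : ℝ → EuclideanSpace ℝ (Fin 3) → ℝ}

/-! ## §1  A concentrated ball is a dissipation floor -/

/-- **Concentration forces dissipation** (the Sobolev end of the scaled energy, read backwards): for a frame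
solution and a time `t ∈ [0, T)`, a ball with `∫_{B(x₁,r)}|u(t)|² > M r`, `r > 0`, forces
`A · δ(t) > M / r`, where `A = sobolevMorreyConst` and `δ(t) = dissipRate u t = ∫ |∇u(t)|²_F`
(`∫_{B(x₁,r)}|u(t)|² ≤ A δ(t) r²`, nsreg-p4's `lintegral_ball_sq_le_sobolev`). -/
theorem ofReal_div_lt_dissipRate_of_concentration (hν : 0 < ν)
    (hsol : IsClassicalNSSolutionOn (Ico 0 T) ν 0 u p) (hLH : IsLerayHopfOn T ν 0 (u 0) u)
    {t : ℝ} (ht : t ∈ Ico 0 T) {x₁ : EuclideanSpace ℝ (Fin 3)} {M r : ℝ} (hr : 0 < r)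
    (hconc : ENNReal.ofReal (M * r) < ∫⁻ x in ball x₁ r, ‖u t x‖ₑ ^ 2) :
    ENNReal.ofReal (M / r) < sobolevMorreyConst * dissipRate u t := by
  have hC1 : ContDiff ℝ 1 (u t) := (hsol.contDiff_velocity ht).of_le (by exact_mod_cast le_top)
  have hL2 : ∫⁻ x, ‖u t x‖ₑ ^ 2 < ⊤ :=
    lt_of_le_of_lt (hLH.lintegral_enorm_sq_le hν.le ⟨ht.1, ht.2.le⟩) ENNReal.ofReal_lt_top
  have hS := lintegral_ball_sq_le_sobolev hC1 hL2 x₁ hr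
  -- `ofReal (M r) < A δ r²`
  have h1 : ENNReal.ofReal (M * r) < sobolevMorreyConst * dissipRate u t * ENNReal.ofReal (r ^ 2) :=
    lt_of_lt_of_le hconc hS
  by_contra hle
  rw [not_lt] at hle
  have h2 : sobolevMorreyConst * dissipRate u t * ENNReal.ofReal (r ^ 2) ≤
      ENNReal.ofReal (M / r) * ENNReal.ofReal (r ^ 2) := mul_le_mul' hle le_rfl
  rw [← ENNReal.ofReal_mul' (by positivity),
    show M / r * r ^ 2 = M * r by rw [pow_two, ← mul_assoc, div_mul_cancel₀ M hr.ne']] at h2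
  exact (lt_irrefl _) (lt_of_lt_of_le h1 h2)

/-! ## §2  Dissipation bursts at the singular points of Morrey-Type-I blow-ups -/

/-- **Dissipation bursts near a singular point** (no local Type I singular point assumed): for a frame solution
in stub 2's class `MorreyTypeINear` and a point `x₀` that is not backward-bounded, for every `Λ` and every
`T₁ < T` there is `t ∈ (T₁, T)` with `A δ(t) > Λ / √(T-t)`.  Proof: deep concentration at level `M` with
`M²/M₀ > Λ` (`exists_deep_concentration_near_of_not_isBackwardBoundedAt`: `∫_{B(x₁,r)}|u(t)|² > M r`,
`M r ≤ M₀ √(T-t)`) and §1: `A δ(t) > M/r ≥ M²/(M₀ √(T-t)) > Λ/√(T-t)`.  CONDITIONAL on `hno`. -/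
theorem exists_dissipation_burst_near_of_not_isBackwardBoundedAt (hno : ¬ LocalTypeISingularityExists)
    (hν : 0 < ν) (hT : 0 < T) (hsol : IsClassicalNSSolutionOn (Ico 0 T) ν 0 u p)
    (hLH : IsLerayHopfOn T ν 0 (u 0) u) (hM : MorreyTypeINear u T)
    {x₀ : EuclideanSpace ℝ (Fin 3)} (hsing : ¬ IsBackwardBoundedAt u T x₀) (Λ : ℝ) {T₁ : ℝ} (hT₁ : T₁ < T) :
    ∃ t ∈ Ioo T₁ T, ENNReal.ofReal (Λ / Real.sqrt (T - t)) < sobolevMorreyConst * dissipRate u t := by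
  obtain ⟨M₀, hM₀, r₁, hr₁, hTop⟩ := hM
  -- the level `M = (|Λ| + 1) (M₀ + 1)`, so that `M² / M₀ > |Λ| ≥ Λ`
  set M : ℝ := (|Λ| + 1) * (M₀ + 1) with hMdef
  have hMpos : 0 < M := by positivity
  have hMsq : Λ * M₀ < M ^ 2 := by
    have h1 : Λ ≤ |Λ| := le_abs_self Λ
    have h2 : 0 ≤ |Λ| := abs_nonneg Λ
    have hM1 : 1 ≤ M := by
      rw [hMdef]; exact one_le_mul_of_one_le_of_one_le (by linarith) (by linarith)
    have hMgt : Λ * M₀ < M := by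
      rw [hMdef]
      have h3 : Λ * M₀ ≤ |Λ| * M₀ := mul_le_mul_of_nonneg_right h1 hM₀.le
      nlinarith
    nlinarith
  -- deep concentration in the window `(max T₁ 0, T)`
  have hT₁' : max T₁ 0 < T := max_lt hT₁ hT
  obtain ⟨t, ht, x₁, -, r, hr, -, hdepth, hconc⟩ :=
    exists_deep_concentration_near_of_not_isBackwardBoundedAt hno hν hT hsol hLH hM₀ hr₁ hTop hsing M
      one_pos hT₁'
  have ht₁ : T₁ < t := lt_of_le_of_lt (le_max_left _ _) ht.1
  have ht0 : 0 ≤ t := (lt_of_le_of_lt (le_max_right _ _) ht.1).le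
  refine ⟨t, ⟨ht₁, ht.2⟩, lt_of_le_of_lt ?_
    (ofReal_div_lt_dissipRate_of_concentration hν hsol hLH ⟨ht0, ht.2⟩ hr hconc)⟩
  -- `Λ/√(T-t) ≤ M/r` from `M r ≤ M₀ √(T-t)` and `Λ M₀ < M²`
  refine ENNReal.ofReal_le_ofReal ?_
  have hs : 0 < Real.sqrt (T - t) := Real.sqrt_pos.2 (sub_pos.2 ht.2)
  rw [div_le_div_iff₀ hs hr]
  -- `Λ r ≤ M √(T-t)`: multiply `M r ≤ M₀ √s` by `Λ ≤ M²/M₀`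
  rcases le_or_gt Λ 0 with hΛ | hΛ
  · nlinarith [hs.le, hr.le]
  · have h3 : Λ * (M * r) ≤ Λ * (M₀ * Real.sqrt (T - t)) := mul_le_mul_of_nonneg_left hdepth hΛ.le
    nlinarith [hs, hr, hM₀]

/-- **Dissipation bursts of Morrey-Type-I frame blow-ups** (no local Type I singular point assumed): a frame
blow-up in stub 2's class `MorreyTypeINear` has, for every `Λ` and in every final window, a time with
`A δ(t) > Λ/√(T-t)` — `limsup_{t → T} √(T-t) ‖∇u(t)‖₂² = ∞`.  CONDITIONAL on `hno`. -/
theorem exists_dissipation_burst_of_morreyTypeI_blowup (hno : ¬ LocalTypeISingularityExists)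
    (hν : 0 < ν) (hT : 0 < T) (hsol : IsClassicalNSSolutionOn (Ico 0 T) ν 0 u p)
    (hLH : IsLerayHopfOn T ν 0 (u 0) u) (hdec : HasRapidSpatialDecay (u 0))
    (hbu : ¬ HasSmoothExtensionPast ν 0 u T) (hM : MorreyTypeINear u T) (Λ : ℝ) {T₁ : ℝ} (hT₁ : T₁ < T) :
    ∃ t ∈ Ioo T₁ T, ENNReal.ofReal (Λ / Real.sqrt (T - t)) < sobolevMorreyConst * dissipRate u t := by
  obtain ⟨x₀, hx₀⟩ := exists_not_isBackwardBoundedAt_of_blowup hν hT hsol hLH hdec hbu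
  exact exists_dissipation_burst_near_of_not_isBackwardBoundedAt hno hν hT hsol hLH hM hx₀ Λ hT₁

/-- **No frame blow-up is both Morrey-Type-I (top windows) and of Leray rate in `Ḣ¹`**, if no local Type I
singular point exists: `MorreyTypeINear u T` excludes a final-window bound `δ(t) ≤ C/√(T-t)` on the dissipation
rate (the rate of Leray's LOWER bound and of self-similar profiles).  CONDITIONAL on `hno`. -/
theorem not_dissipLerayRate_of_morreyTypeI_blowup (hno : ¬ LocalTypeISingularityExists)
    (hν : 0 < ν) (hT : 0 < T) (hsol : IsClassicalNSSolutionOn (Ico 0 T) ν 0 u p)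
    (hLH : IsLerayHopfOn T ν 0 (u 0) u) (hdec : HasRapidSpatialDecay (u 0))
    (hbu : ¬ HasSmoothExtensionPast ν 0 u T) (hM : MorreyTypeINear u T) :
    ¬ ∃ C : ℝ, ∃ T₁ < T, ∀ t ∈ Ioo T₁ T, dissipRate u t ≤ ENNReal.ofReal (C / Real.sqrt (T - t)) := by
  rintro ⟨C, T₁, hT₁, hrate⟩
  have hAtop : sobolevMorreyConst ≠ ⊤ := sobolevMorreyConst_lt_top.ne
  set a : ℝ := sobolevMorreyConst.toReal with ha
  have ha0 : 0 ≤ a := ENNReal.toReal_nonneg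
  obtain ⟨t, ht, hburst⟩ :=
    exists_dissipation_burst_of_morreyTypeI_blowup hno hν hT hsol hLH hdec hbu hM (a * |C| + 1) hT₁
  have hs : 0 < Real.sqrt (T - t) := Real.sqrt_pos.2 (sub_pos.2 ht.2)
  -- `A δ(t) ≤ ofReal (a |C| / √s)`
  have hup : sobolevMorreyConst * dissipRate u t ≤ ENNReal.ofReal (a * |C| / Real.sqrt (T - t)) := by
    calc sobolevMorreyConst * dissipRate u t
        ≤ sobolevMorreyConst * ENNReal.ofReal (C / Real.sqrt (T - t)) := mul_le_mul' le_rfl (hrate t ht)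
      _ ≤ ENNReal.ofReal a * ENNReal.ofReal (|C| / Real.sqrt (T - t)) := by
          rw [ENNReal.ofReal_toReal hAtop]
          exact mul_le_mul' le_rfl (ENNReal.ofReal_le_ofReal
            (div_le_div_of_nonneg_right (le_abs_self C) hs.le))
      _ = ENNReal.ofReal (a * |C| / Real.sqrt (T - t)) := by
          rw [← ENNReal.ofReal_mul ha0, mul_div_assoc]
  have h := lt_of_lt_of_le hburst hup
  rw [ENNReal.ofReal_lt_ofReal_iff_of_nonneg (by positivity)] at h
  rw [div_lt_div_iff_of_pos_right hs] at h
  linarith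

/-! ## §3  The same under hard core `stmt-NavierStokesRegularity-10661` (L) BY NAME -/

/-- **(L) ⇒ dissipation bursts of Morrey-Type-I blow-ups** (hard core 10661 BY NAME). -/
theorem exists_dissipation_burst_of_morreyTypeI_blowup_of_typeIliouvilleL
    (hL : Summit.NavierStokesRegularity.NavierStokesRegularity.Theses.TypeILiouville.TypeIliouvilleL)
    (hν : 0 < ν) (hT : 0 < T) (hsol : IsClassicalNSSolutionOn (Ico 0 T) ν 0 u p)
    (hLH : IsLerayHopfOn T ν 0 (u 0) u) (hdec : HasRapidSpatialDecay (u 0))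
    (hbu : ¬ HasSmoothExtensionPast ν 0 u T) (hM : MorreyTypeINear u T) (Λ : ℝ) {T₁ : ℝ} (hT₁ : T₁ < T) :
    ∃ t ∈ Ioo T₁ T, ENNReal.ofReal (Λ / Real.sqrt (T - t)) < sobolevMorreyConst * dissipRate u t :=
  exists_dissipation_burst_of_morreyTypeI_blowup (not_localTypeISingularityExists_of_typeIliouvilleL hL)
    hν hT hsol hLH hdec hbu hM Λ hT₁

/-- **(L) ⇒ no frame blow-up is both Barker–Prange-Type-I (1.7) and of Leray rate in `Ḣ¹`** (hard core 10661
BY NAME). -/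
theorem not_dissipLerayRate_of_morreyTypeI_blowup_of_typeIliouvilleL
    (hL : Summit.NavierStokesRegularity.NavierStokesRegularity.Theses.TypeILiouville.TypeIliouvilleL)
    (hν : 0 < ν) (hT : 0 < T) (hsol : IsClassicalNSSolutionOn (Ico 0 T) ν 0 u p)
    (hLH : IsLerayHopfOn T ν 0 (u 0) u) (hdec : HasRapidSpatialDecay (u 0))
    (hbu : ¬ HasSmoothExtensionPast ν 0 u T) (hM : MorreyTypeINear u T) :
    ¬ ∃ C : ℝ, ∃ T₁ < T, ∀ t ∈ Ioo T₁ T, dissipRate u t ≤ ENNReal.ofReal (C / Real.sqrt (T - t)) :=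
  not_dissipLerayRate_of_morreyTypeI_blowup (not_localTypeISingularityExists_of_typeIliouvilleL hL)
    hν hT hsol hLH hdec hbu hM

end Summit.NavierStokesRegularity.NavierStokesRegularity.Theorems.L3TimeExponentPincerMorreyTypeIDissipationBursts

end
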